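import Summits.KontsevichZagierPeriods.Zeta5Search.Barrier.ConeGammaTranslateTangentConeOrbit
import Summits.KontsevichZagierPeriods.Zeta5Search.Barrier.ConeGammaCuspPeriodFarkas
import Summits.KontsevichZagierPeriods.Zeta5Search.Barrier.ConeGammaCuspPeriodRays

/-!
# ζ(5) search — BARRIER: THE CLOSED ORBIT'S LOCAL MAXIMALITY FOR THE TRANSLATE INTEGRAL IN CERTIFICATE FORM
# (file (5), SEQUEL of «THE UNIFORM TANGENT CONE»)

HONEST FRAMING (cell `pub-zeta5`): systematic search; no irrationality claim unless kernel-certified. MODEL objects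
under Brown–Zudilin's (28)+(30) accounting ([BZ22] = arXiv:2210.03391; (28) observed, not proved); nothing here is a
statement about `ζ(5)`, any `γ` of record, the cone's supremum (C2 OPEN) or the value / sign of the cusp slope or of the
translate integral at a named direction: NO certificate instance is asserted for any direction (at the directions of record
ascent directions EXIST — DATA, so there the closed orbit is NOT a local maximiser of the MODEL `P`; not used here); NO
cancellation is quantified; S-E / (TD_A) stay CONJECTURED; records in print UNMOVED. Prover P2 g43 (sequel of the item «THE
UNIFORM TANGENT CONE»; plan INBOX 2026-08-28). Sources: file (4) `ConeGammaTranslateTangentConeOrbit`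
(`isLocalMax_translateIntegral_zero_iff`: the closed orbit is a local maximiser of `P` iff `σ ≤ 0` everywhere), P2 g34/g35
`ConeGammaCuspPeriodFarkas` / `ConeGammaCuspPeriodRays` / `ConeGammaCuspPeriodGordanCanonical` (the three finite tests for «`σ ≤ 0`
in every direction»: chamber Farkas certificates, the rays of the rate arrangement, the hull condition).

SETTING. `a` with all 28 forms positive, `T > 0` a period, `σ = cuspSlope a T`, `P = translateIntegral a T`, `F` the canonical
period pattern function, `W_k(δ₀)` the canonical chamber weights. The statement «the closed orbit `δ = 0` is a local
maximiser of the MODEL translate integral» — static translate dominance IN THE SMALL — is decided by FINITELY MANY checks on the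
cell's own objects:
* **`isLocalMax_translateIntegral_zero_iff_forall_farkas_certificate`** — iff every generic reference `δ₀` carries a Farkas
  certificate `μ ≥ 0` with `Σ_k W_k(δ₀)·r_k + Σ_{ρ₀k<ρ₀l} μ_{kl}(r_l − r_k) ≡ 0` (H-description);
* **`isLocalMax_translateIntegral_zero_iff_forall_ray`** — iff `σ ≤ 0` at every RAY of the rate arrangement (rates in
  `[0, 1]`, two distinct, rigid tie pattern — a finite test set depending on the direction alone; V-description);
  `not_isLocalMax_translateIntegral_zero_iff_exists_ascent_ray` — the contrapositive: the closed orbit FAILS to be a local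
  maximiser iff some ray ascends;
* **`hull_certificate_of_isLocalMax_translateIntegral_zero`** — necessary: at most EIGHT generic references with positive
  weights whose chamber gradients have `0` in their convex hull; `exists_greedy_nonpos_of_isLocalMax_translateIntegral_zero`.
NOT here (honest): any certificate instance, any value of `W_k` or `σ` at a named direction (DATA); local maximality of `P` at
translates `δ ≠ 0` in certificate form (file (3) gives the one-sided-derivative criterion; its Farkas form is not filed);
`Φ`, `γ`, C2, S-E's truth, `ζ(5)`.
-/

noncomputable section

open Set Finset Filter
open scoped Topology

namespace Summit.KontsevichZagierPeriods.Zeta5Search.Barrier.ConeGamma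

/-- **THE CLOSED ORBIT IS A LOCAL MAXIMISER OF `P` IFF EVERY CHAMBER CARRIES A FARKAS CERTIFICATE.** All 28 forms of `a`
positive, `T > 0` a period, `F` the canonical period pattern function:
`IsLocalMax (translateIntegral a T) 0 ↔ ∀ δ₀ generic, ∃ μ ≥ 0, Σ_k W_k(δ₀)·r_k(δ) + Σ_{ρ₀k<ρ₀l} μ_{kl}(r_l(δ) − r_k(δ)) = 0 ∀ δ`. -/
theorem isLocalMax_translateIntegral_zero_iff_forall_farkas_certificate {a : Dir} (hpos : ∀ k, 0 < h28 a k) {T : ℝ}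
    (hT : 0 < T) (hper : ∀ k : Fin 28, ∃ z : ℤ, T * h28 a k = z) {F : Finset (Fin 28) → ℝ}
    (hF : ∀ A, F A = ∑ m ∈ Finset.range ((bkpts a T).card - 1), ((patternN a (bkpt a T m) A : ℤ) : ℝ)) :
    IsLocalMax (translateIntegral a T) 0 ↔
      ∀ δ₀ : Fin 8 → ℝ, (∀ k l : Fin 28, k ≠ l → phiForm δ₀ k / h28 a k ≠ phiForm δ₀ l / h28 a l) →
        ∃ μ : Fin 28 → Fin 28 → ℝ, (∀ k l, 0 ≤ μ k l) ∧ ∀ δ : Fin 8 → ℝ,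
          ∑ k, (F (Finset.univ.filter fun l => phiForm δ₀ k / h28 a k ≤ phiForm δ₀ l / h28 a l) -
              F (Finset.univ.filter fun l => phiForm δ₀ k / h28 a k < phiForm δ₀ l / h28 a l)) *
            (phiForm δ k / h28 a k) +
          ∑ k, ∑ l, (if phiForm δ₀ k / h28 a k < phiForm δ₀ l / h28 a l then
            μ k l * (phiForm δ l / h28 a l - phiForm δ k / h28 a k) else 0) = 0 := by
  rw [isLocalMax_translateIntegral_zero_iff hpos hT hper]
  exact forall_cuspSlope_nonpos_iff_forall_farkas_certificate_canonical hpos hT hper hF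

/-- **THE CLOSED ORBIT IS A LOCAL MAXIMISER OF `P` IFF THE CUSP SLOPE IS `≤ 0` AT EVERY RAY OF THE RATE ARRANGEMENT** (rays:
rates in `[0, 1]`, two of them distinct, and every displacement with the same ties is a combination of the ray and `s(a)`). -/
theorem isLocalMax_translateIntegral_zero_iff_forall_ray {a : Dir} (hpos : ∀ k, 0 < h28 a k) {T : ℝ} (hT : 0 < T)
    (hper : ∀ k : Fin 28, ∃ z : ℤ, T * h28 a k = z) :
    IsLocalMax (translateIntegral a T) 0 ↔
      ∀ x : Fin 8 → ℝ, (∀ k, 0 ≤ phiForm x k / h28 a k ∧ phiForm x k / h28 a k ≤ 1) →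
        ((∃ k l, phiForm x k / h28 a k ≠ phiForm x l / h28 a l) ∧
          ∀ d : Fin 8 → ℝ, (∀ k l, phiForm x k / h28 a k = phiForm x l / h28 a l →
            phiForm d k / h28 a k = phiForm d l / h28 a l) → ∃ u t : ℝ, d = u • x + t • sParam a) →
        cuspSlope a T x ≤ 0 := by
  classical
  obtain ⟨F, hF⟩ : ∃ F : Finset (Fin 28) → ℝ,
      ∀ A, F A = ∑ m ∈ Finset.range ((bkpts a T).card - 1), ((patternN a (bkpt a T m) A : ℤ) : ℝ) := ⟨_, fun _ => rfl⟩
  rw [isLocalMax_translateIntegral_zero_iff hpos hT hper]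
  exact forall_cuspSlope_nonpos_iff_forall_ray_canonical hpos hT hper hF

/-- **THE CLOSED ORBIT FAILS TO BE A LOCAL MAXIMISER OF `P` IFF SOME RAY OF THE RATE ARRANGEMENT ASCENDS.** -/
theorem not_isLocalMax_translateIntegral_zero_iff_exists_ascent_ray {a : Dir} (hpos : ∀ k, 0 < h28 a k) {T : ℝ}
    (hT : 0 < T) (hper : ∀ k : Fin 28, ∃ z : ℤ, T * h28 a k = z) :
    ¬IsLocalMax (translateIntegral a T) 0 ↔
      ∃ x : Fin 8 → ℝ, (∀ k, 0 ≤ phiForm x k / h28 a k ∧ phiForm x k / h28 a k ≤ 1) ∧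
        ((∃ k l, phiForm x k / h28 a k ≠ phiForm x l / h28 a l) ∧
          ∀ d : Fin 8 → ℝ, (∀ k l, phiForm x k / h28 a k = phiForm x l / h28 a l →
            phiForm d k / h28 a k = phiForm d l / h28 a l) → ∃ u t : ℝ, d = u • x + t • sParam a) ∧
        0 < cuspSlope a T x := by
  classical
  obtain ⟨F, hF⟩ : ∃ F : Finset (Fin 28) → ℝ,
      ∀ A, F A = ∑ m ∈ Finset.range ((bkpts a T).card - 1), ((patternN a (bkpt a T m) A : ℤ) : ℝ) := ⟨_, fun _ => rfl⟩
  have h := exists_ascent_iff_exists_ascent_ray hpos hT hper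
    (M := fun m => Finset.univ.filter fun k => ∃ z : ℤ, bkpt a T m * h28 a k = z)
    (f := fun m A => ((patternN a (bkpt a T m) A : ℤ) : ℝ)) (canonical_junction_agreement a T)
    (canonical_period_eq_sum_inter hF)
  rw [isLocalMax_translateIntegral_zero_iff hpos hT hper, ← h]
  simp only [not_forall, not_le]

/-- **AT A LOCALLY MAXIMAL CLOSED ORBIT: ZERO IN THE HULL OF AT MOST EIGHT CHAMBER GRADIENTS** (necessary condition): if the
closed orbit is a local maximiser of `P`, there are at most eight generic references `δ₀ ∈ s` and positive weights `t` with
`Σ_{δ₀∈s} t δ₀ · Σ_k W_k(δ₀)·r_k(δ) = 0` for every `δ`. -/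
theorem hull_certificate_of_isLocalMax_translateIntegral_zero {a : Dir} (hpos : ∀ k, 0 < h28 a k) {T : ℝ} (hT : 0 < T)
    (hper : ∀ k : Fin 28, ∃ z : ℤ, T * h28 a k = z) {F : Finset (Fin 28) → ℝ}
    (hF : ∀ A, F A = ∑ m ∈ Finset.range ((bkpts a T).card - 1), ((patternN a (bkpt a T m) A : ℤ) : ℝ))
    (hmax : IsLocalMax (translateIntegral a T) 0) :
    ∃ (s : Finset (Fin 8 → ℝ)) (t : (Fin 8 → ℝ) → ℝ), s.card ≤ 8 ∧
      (∀ δ₀ ∈ s, ∀ k l : Fin 28, k ≠ l → phiForm δ₀ k / h28 a k ≠ phiForm δ₀ l / h28 a l) ∧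
        (∀ δ₀ ∈ s, 0 < t δ₀) ∧ 0 < ∑ δ₀ ∈ s, t δ₀ ∧
          ∀ δ : Fin 8 → ℝ, ∑ δ₀ ∈ s, t δ₀ *
            ∑ k, (F (Finset.univ.filter fun l => phiForm δ₀ k / h28 a k ≤ phiForm δ₀ l / h28 a l) -
                F (Finset.univ.filter fun l => phiForm δ₀ k / h28 a k < phiForm δ₀ l / h28 a l)) *
              (phiForm δ k / h28 a k) = 0 :=
  hull_certificate_of_forall_cuspSlope_nonpos_canonical hpos hT hper hF
    ((isLocalMax_translateIntegral_zero_iff hpos hT hper).mp hmax)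

/-- **AT A LOCALLY MAXIMAL CLOSED ORBIT THERE IS NO UNIFORM ASCENT DISPLACEMENT**: at every displacement `δ` SOME generic
reference's canonical chamber functional is `≤ 0`. -/
theorem exists_greedy_nonpos_of_isLocalMax_translateIntegral_zero {a : Dir} (hpos : ∀ k, 0 < h28 a k) {T : ℝ} (hT : 0 < T)
    (hper : ∀ k : Fin 28, ∃ z : ℤ, T * h28 a k = z) {F : Finset (Fin 28) → ℝ}
    (hF : ∀ A, F A = ∑ m ∈ Finset.range ((bkpts a T).card - 1), ((patternN a (bkpt a T m) A : ℤ) : ℝ))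
    (hmax : IsLocalMax (translateIntegral a T) 0) (δ : Fin 8 → ℝ) :
    ∃ δ₀ : Fin 8 → ℝ, (∀ k l : Fin 28, k ≠ l → phiForm δ₀ k / h28 a k ≠ phiForm δ₀ l / h28 a l) ∧
      ∑ k, (F (Finset.univ.filter fun l => phiForm δ₀ k / h28 a k ≤ phiForm δ₀ l / h28 a l) -
          F (Finset.univ.filter fun l => phiForm δ₀ k / h28 a k < phiForm δ₀ l / h28 a l)) *
        (phiForm δ k / h28 a k) ≤ 0 :=
  exists_greedy_nonpos_of_forall_cuspSlope_nonpos_canonical hpos hT hper hF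
    ((isLocalMax_translateIntegral_zero_iff hpos hT hper).mp hmax) δ

end Summit.KontsevichZagierPeriods.Zeta5Search.Barrier.ConeGamma

end
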